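import Literature.Combinatorics.SimpleGraph.LovaszThetaFWAlgorithm
import Literature.Analysis.Convexity.FrankWolfeRecurrence
import Mathlib.Analysis.SpecialFunctions.Exp
import HarnessLib

/-!
# Correctness of the integer Frank–Wolfe algorithm for the Lovász number

Topic `Combinatorics/SimpleGraph`, completing `LovaszThetaFWAlgorithm.lean` (the finite-precision
algorithm `ThetaFW`: constants `M = n⁶m`, `c₀ = n(1+2M)`, `q = 32mc₀`, `k = ⌊log₂(nq)⌋+1`, `r = qk`,
`T = 512n⁶m²`, `p = ⌊log₂(2¹⁵n¹⁶m⁴)⌋+1`; integer iterates `fwIter`, output `thetaZ`) with its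
CONVERGENCE AND OUTPUT ANALYSIS. Everything here is PROVED:

* `ThetaFW.power_hyp` — the power-method hypothesis `n(1 - 1/q)ʳ ≤ 1/q` of
  `LovaszThetaFrankWolfe.powerOracle` holds for `r = qk` (`(1 - 1/q)^{qk} ≤ e^{-k} ≤ 2^{-k} < 1/(nq)`);
* `ThetaFW.fwIter_good` — every iterate `N_t` is positive semidefinite (as a real matrix) with
  positive trace and entries bounded by `2ᵖ + n + 1`: the rounded step is
  `N⁺ = 2ᵖY - R + n·1` with `Y ∈ Δ` the exact Frank–Wolfe iterate and `0 ≤ Rᵢⱼ < 1` the rounding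
  defect, and `n·1 - R ⪰ 0` by the Gershgorin-type shift (`posSemidef_add_smul_one`);
* `ThetaFW.fwStep_good` (last component) — the represented point `B⁺ = N⁺/Tr N⁺` is entrywise
  within `(n² + n + 1)/2ᵖ` of `Y`, whence (`abs_penaltyObj_fwStep_sub_le`, through
  `abs_penaltyObj_sub_le`) the objective moves by at most `ρ = n²·(n²+n+1)/2ᵖ·(1+3M)` per step;
* `ThetaFW.err_fwFinal_lt` — Jaggi's recurrence (`frankWolfe_recurrence`, with the oracle error
  `4εc₀ = 1/(8m)` of `frankWolfe_powerStep` and the perturbation `ρ`) gives after `T` steps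
  `ϑ(H) - f_M(B_T) < 1/(32m) + 1/(8m) + 3/(16m) < 3/(8m)`;
* `ThetaFW.thetaZ_spec` — **the output is correct**: `m·ϑ(H) ≤ z ≤ m·ϑ(H) + 2` for
  `z = thetaZ n m H = ⌈m f_M(B_T) + 3/8⌉` (`outNum_div`, `ceilDiv_bracket`, and
  `f_M ≤ ϑ + n⁶/(4M) = ϑ + 1/(4m)` from `penaltyObj_le`), for all `n, m ≥ 1`; `thetaZ_nonneg`,
  `thetaZ_toNat_spec` (the form consumed by the machine-level discharge of
  `Literature.Computability.Complexity.GLS1981_thetaApprox_unary_FP`).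

This is Jaggi 2011, Thm. 17/18 (Hazan's algorithm with approximate eigenvector computations),
specialised to the penalised theta objective and carried out in exact integer arithmetic with
`p` fractional bits; the printed `O(1/ε)` iteration count appears as `T = 512 n⁶ m²` for the target
accuracy `3/(8m)` and curvature `4M = 4n⁶m`.

## References

* M. Jaggi, *Convex optimization without projection steps*, arXiv:1108.1170 (2011), §3 Thm. 3,
  §4 Alg. 6, Thm. 17, Thm. 18 [Jaggi2011]; E. Hazan, LATIN 2008 [Hazan2008].
* M. Grötschel, L. Lovász, A. Schrijver, Combinatorica 1 (1981) 169–197, §6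
  [GrotschelLovaszSchrijver1981] (the statement this analysis serves; their algorithm is the
  ellipsoid method).
-/

noncomputable section

open Matrix Finset

namespace Literature.Combinatorics.SimpleGraph

namespace ThetaFW

open Literature.LinearAlgebra.Matrix Literature.Analysis.Convexity

variable {n m : ℕ} {H : _root_.SimpleGraph (Fin n)} [DecidableRel H.Adj]

/-! ### The constants -/

/-- `M = n⁶ m ≥ 1` for `n, m ≥ 1`. [folklore] -/
theorem one_le_cM (hn : 1 ≤ n) (hm : 1 ≤ m) : 1 ≤ cM n m := by
  unfold cM; exact Nat.mul_pos (Nat.pow_pos hn) hm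

/-- Cast of `M`. [folklore] -/
theorem cM_cast : ((cM n m : ℕ) : ℝ) = (n : ℝ) ^ 6 * m := by simp [cM]

/-- Cast of `c₀ = n(1 + 2M)`. [folklore] -/
theorem c0_cast : ((c0 n m : ℕ) : ℝ) = n * (1 + 2 * (cM n m : ℝ)) := by simp [c0]

/-- Cast of `q = 32 m c₀`. [folklore] -/
theorem cq_cast : ((cq n m : ℕ) : ℝ) = 32 * m * (c0 n m : ℝ) := by simp [cq]

/-- Cast of `T = 512 n⁶ m²`. [folklore] -/
theorem cT_cast : ((cT n m : ℕ) : ℝ) = 512 * (n : ℝ) ^ 6 * (m : ℝ) ^ 2 := by simp [cT]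

/-- `c₀ ≥ 1` for `n ≥ 1`. [folklore] -/
theorem one_le_c0 (hn : 1 ≤ n) : 1 ≤ c0 n m := by
  unfold c0; exact Nat.mul_pos hn (Nat.add_pos_left Nat.one_pos _)

/-- `q ≥ 1` for `n, m ≥ 1`. [folklore] -/
theorem one_le_cq (hn : 1 ≤ n) (hm : 1 ≤ m) : 1 ≤ cq n m := by
  unfold cq; exact Nat.mul_pos (Nat.mul_pos (by norm_num) hm) (one_le_c0 hn)

/-- `T ≥ 1` for `n, m ≥ 1`. [folklore] -/
theorem one_le_cT (hn : 1 ≤ n) (hm : 1 ≤ m) : 1 ≤ cT n m := by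
  unfold cT; exact Nat.mul_pos (Nat.mul_pos (by norm_num) (Nat.pow_pos hn)) (Nat.pow_pos hm)

/-- `2ᵏ > n q` (`k = ⌊log₂(nq)⌋ + 1`). [folklore] -/
theorem lt_two_pow_ck : n * cq n m < 2 ^ ck n m := Nat.lt_pow_succ_log_self one_lt_two _

/-- `2ᵖ > 2¹⁵ n¹⁶ m⁴` (`p = ⌊log₂(2¹⁵n¹⁶m⁴)⌋ + 1`). [folklore] -/
theorem lt_two_pow_cp : 2 ^ 15 * n ^ 16 * m ^ 4 < 2 ^ cp n m := Nat.lt_pow_succ_log_self one_lt_two _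

/-- The same in `ℝ`. [folklore] -/
theorem lt_two_pow_cp_real : (2 : ℝ) ^ 15 * (n : ℝ) ^ 16 * (m : ℝ) ^ 4 < 2 ^ cp n m := by
  exact_mod_cast (lt_two_pow_cp (n := n) (m := m))

/-- `n² + n + 1 ≤ 2ᵖ` (indeed `3n² ≤ 2¹⁵n¹⁶m⁴ < 2ᵖ`). [folklore] -/
theorem quad_le_two_pow_cp (hn : 1 ≤ n) (hm : 1 ≤ m) : (n : ℝ) ^ 2 + n + 1 ≤ 2 ^ cp n m := by
  have hn' : (1 : ℝ) ≤ n := by exact_mod_cast hn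
  have hm' : (1 : ℝ) ≤ m := by exact_mod_cast hm
  have h1 : (n : ℝ) ^ 2 + n + 1 ≤ 3 * (n : ℝ) ^ 2 := by nlinarith
  have h2 : (n : ℝ) ^ 2 ≤ (n : ℝ) ^ 16 := pow_le_pow_right₀ hn' (by norm_num)
  have h3 : (1 : ℝ) ≤ (m : ℝ) ^ 4 := one_le_pow₀ hm'
  have h4 : 3 * (n : ℝ) ^ 2 ≤ (2 : ℝ) ^ 15 * (n : ℝ) ^ 16 * (m : ℝ) ^ 4 := by
    have h5 : (0 : ℝ) ≤ (n : ℝ) ^ 16 := by positivity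
    nlinarith [mul_le_mul_of_nonneg_left h3 h5]
  linarith [lt_two_pow_cp_real (n := n) (m := m)]

/-- **The power-method hypothesis**: `n (1 - 1/q)ʳ ≤ 1/q` for `r = q k`, since
`(1 - 1/q)^{qk} ≤ e^{-k} ≤ 2^{-k} < 1/(nq)`. [cite: Jaggi2011, Thm. 18 (chunk p0022)] -/
theorem power_hyp (hn : 1 ≤ n) (hm : 1 ≤ m) :
    (n : ℝ) * (1 - 1 / (cq n m : ℝ)) ^ cr n m ≤ 1 / (cq n m : ℝ) := by
  have hq1 : (1 : ℝ) ≤ (cq n m : ℝ) := by exact_mod_cast one_le_cq hn hm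
  have hq0 : (0 : ℝ) < (cq n m : ℝ) := by linarith
  have hqne : (cq n m : ℝ) ≠ 0 := hq0.ne'
  -- `(1 - 1/q)^(qk) ≤ exp(-k)`
  have h1 : (1 - 1 / (cq n m : ℝ)) ^ cr n m ≤ Real.exp (-(ck n m : ℝ)) := by
    have hbase : 1 - 1 / (cq n m : ℝ) ≤ Real.exp (-(1 / (cq n m : ℝ))) := Real.one_sub_le_exp_neg _
    have hb0 : 0 ≤ 1 - 1 / (cq n m : ℝ) := by
      rw [sub_nonneg, div_le_one hq0]; exact hq1
    calc (1 - 1 / (cq n m : ℝ)) ^ cr n m ≤ (Real.exp (-(1 / (cq n m : ℝ)))) ^ cr n m :=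
          pow_le_pow_left₀ hb0 hbase _
      _ = Real.exp (-(ck n m : ℝ)) := by
          rw [← Real.exp_nat_mul, cr]
          congr 1
          push_cast
          field_simp
  -- `exp(-k) ≤ 2^{-k}`
  have h2 : Real.exp (-(ck n m : ℝ)) ≤ 1 / (2 : ℝ) ^ ck n m := by
    rw [Real.exp_neg, one_div]
    apply inv_anti₀ (by positivity)
    calc (2 : ℝ) ^ ck n m ≤ (Real.exp 1) ^ ck n m :=
          pow_le_pow_left₀ (by norm_num) (by linarith [Real.add_one_le_exp (1 : ℝ)]) _
      _ = Real.exp (ck n m : ℝ) := by rw [← Real.exp_nat_mul, mul_one]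
  -- `n 2^{-k} ≤ 1/q`
  have h3 : (n : ℝ) * (1 / (2 : ℝ) ^ ck n m) ≤ 1 / (cq n m : ℝ) := by
    rw [mul_one_div, div_le_div_iff₀ (by positivity) hq0, one_mul]
    exact_mod_cast (lt_two_pow_ck (n := n) (m := m)).le
  calc (n : ℝ) * (1 - 1 / (cq n m : ℝ)) ^ cr n m ≤ n * Real.exp (-(ck n m : ℝ)) :=
        mul_le_mul_of_nonneg_left h1 (Nat.cast_nonneg _)
    _ ≤ n * (1 / (2 : ℝ) ^ ck n m) := mul_le_mul_of_nonneg_left h2 (Nat.cast_nonneg _)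
    _ ≤ 1 / (cq n m : ℝ) := h3

/-! ### The represented point and the exact Frank–Wolfe step -/

/-- A positive semidefinite integer state with positive trace represents a point of the
spectraplex. [folklore] -/
theorem isSpectraplex_bOf {N : Matrix (Fin n) (Fin n) ℤ} (hpsd : (toR N).PosSemidef)
    (hτ : 0 < N.trace) : IsSpectraplex (bOf N) := by
  have hτ' : (0 : ℝ) < (N.trace : ℝ) := by exact_mod_cast hτ
  refine ⟨hpsd.smul (inv_nonneg.2 hτ'.le), ?_⟩
  rw [bOf, trace_smul, trace_toR, smul_eq_mul, inv_mul_cancel₀ hτ'.ne']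

/-- **The exact Frank–Wolfe step from a good state** (`frankWolfe_powerStep` with the constants of
`ThetaFW`): `W, Y ∈ Δ`, the decrease inequality with oracle error `4εc₀ = 4c₀/q`, and
`Tr(Aʳ) > 0`. [cite: Jaggi2011, Alg. 6, Thm. 17 and Thm. 18 (chunks p0020–p0022)] -/
theorem fw_facts (hn : 1 ≤ n) (hm : 1 ≤ m) (t : ℕ) {N : Matrix (Fin n) (Fin n) ℤ}
    (hpsd : (toR N).PosSemidef) (hτ : 0 < N.trace) :
    IsSpectraplex (wOf (m := m) (H := H) N) ∧ IsSpectraplex (yOf (m := m) (H := H) t N) ∧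
    lovaszTheta H - penaltyObj H (cM n m : ℝ) (yOf (m := m) (H := H) t N) ≤
      (1 - 2 / ((t : ℝ) + 2)) * (lovaszTheta H - penaltyObj H (cM n m : ℝ) (bOf N)) +
        2 / ((t : ℝ) + 2) * (4 * (1 / (cq n m : ℝ)) * (c0 n m : ℝ)) +
        (2 / ((t : ℝ) + 2)) ^ 2 * (4 * (cM n m : ℝ)) ∧
    0 < (aOf (m := m) (H := H) N ^ cr n m).trace := by
  haveI : Nonempty (Fin n) := ⟨⟨0, hn⟩⟩
  have hB := isSpectraplex_bOf hpsd hτ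
  have hM : (0 : ℝ) ≤ (cM n m : ℝ) := Nat.cast_nonneg _
  have hc₀ : (Fintype.card (Fin n) : ℝ) * (1 + 2 * (cM n m : ℝ)) ≤ (c0 n m : ℝ) := by
    rw [Fintype.card_fin, c0_cast]
  have hq1 : (1 : ℝ) ≤ (cq n m : ℝ) := by exact_mod_cast one_le_cq hn hm
  have hε0 : (0 : ℝ) ≤ 1 / (cq n m : ℝ) := by positivity
  have hε1 : 1 / (cq n m : ℝ) ≤ 1 := by rw [div_le_one (by linarith)]; exact hq1
  have hr : (Fintype.card (Fin n) : ℝ) * (1 - 1 / (cq n m : ℝ)) ^ cr n m ≤ 1 / (cq n m : ℝ) := by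
    rw [Fintype.card_fin]; exact power_hyp hn hm
  have hα0 : (0 : ℝ) ≤ 2 / ((t : ℝ) + 2) := by positivity
  have hα1 : 2 / ((t : ℝ) + 2) ≤ 1 := by
    rw [div_le_one (by positivity)]; linarith [(Nat.cast_nonneg t : (0 : ℝ) ≤ t)]
  have hstep := frankWolfe_powerStep (H := H) hM hB hc₀ hε0 hε1 hr hα0 hα1
  obtain ⟨hW, hY, hdec⟩ := hstep
  obtain ⟨-, htr, -⟩ := powerOracle (H := H) hM hB hc₀ hε0 hε1 hr
  exact ⟨hW, hY, hdec, htr⟩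

/-- The step denominator `(t+2) τ Tr P` is positive on a good state. [folklore] -/
theorem stepDen_pos (hn : 1 ≤ n) (hm : 1 ≤ m) (t : ℕ) {N : Matrix (Fin n) (Fin n) ℤ}
    (hpsd : (toR N).PosSemidef) (hτ : 0 < N.trace) :
    0 < stepDen n t N (powInt n m H N) := by
  have htrA := (fw_facts (H := H) hn hm t hpsd hτ).2.2.2
  have hτ' : (0 : ℝ) < (N.trace : ℝ) := by exact_mod_cast hτ
  have hP : (0 : ℝ) < ((powInt n m H N).trace : ℝ) := by
    rw [trace_powInt hτ.ne']; positivity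
  have hP' : 0 < (powInt n m H N).trace := by exact_mod_cast hP
  have ht : (0 : ℤ) < (t : ℤ) + 2 := by positivity
  unfold stepDen
  exact mul_pos (mul_pos ht hτ) hP'

/-- **The rounding bracket**: `N⁺ᵢⱼ - n[i=j] = ⌊2ᵖ Yᵢⱼ⌋`, i.e.
`N⁺ᵢⱼ - n[i=j] ≤ 2ᵖ Yᵢⱼ < N⁺ᵢⱼ - n[i=j] + 1`. [folklore] -/
theorem fwStep_bracket (hn : 1 ≤ n) (hm : 1 ≤ m) (t : ℕ) {N : Matrix (Fin n) (Fin n) ℤ}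
    (hpsd : (toR N).PosSemidef) (hτ : 0 < N.trace) (i j : Fin n) :
    ((fwStep n m H t N i j : ℤ) : ℝ) - (if i = j then (n : ℝ) else 0) ≤
        2 ^ cp n m * yOf (m := m) (H := H) t N i j ∧
      2 ^ cp n m * yOf (m := m) (H := H) t N i j <
        ((fwStep n m H t N i j : ℤ) : ℝ) - (if i = j then (n : ℝ) else 0) + 1 := by
  have hd := stepDen_pos (H := H) hn hm t hpsd hτ
  have htrA := (fw_facts (H := H) hn hm t hpsd hτ).2.2.2
  have hq := stepNum_div_stepDen (m := m) (H := H) t hτ.ne' htrA.ne' i j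
  obtain ⟨h1, h2⟩ := ediv_bracket (stepNum n m t N (powInt n m H N) i j) hd
  rw [hq] at h1 h2
  have hF : ((fwStep n m H t N i j : ℤ) : ℝ) - (if i = j then (n : ℝ) else 0) =
      ((stepNum n m t N (powInt n m H N) i j / stepDen n t N (powInt n m H N) : ℤ) : ℝ) := by
    simp only [fwStep]
    push_cast
    split_ifs <;> ring
  rw [hF]
  exact ⟨h1, h2⟩

/-! ### One rounded step preserves the invariant -/

/-- **The rounded step from a good state**: `N⁺ = fwStep t N` is positive semidefinite, its
trace satisfies `2ᵖ + n² - n ≤ Tr N⁺ ≤ 2ᵖ + n²`, its entries are bounded by `2ᵖ + n + 1` in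
absolute value, and it represents a point within `(n² + n + 1)/2ᵖ` of the exact iterate `Y`
entrywise. [cite: Jaggi2011, Alg. 6 and Thm. 17 (chunks p0020–p0022)] -/
theorem fwStep_good (hn : 1 ≤ n) (hm : 1 ≤ m) (t : ℕ) {N : Matrix (Fin n) (Fin n) ℤ}
    (hsymm : N.IsSymm) (hpsd : (toR N).PosSemidef) (hτ : 0 < N.trace) :
    (toR (fwStep n m H t N)).PosSemidef ∧
    ((2 : ℝ) ^ cp n m + (n : ℝ) ^ 2 - n ≤ ((fwStep n m H t N).trace : ℝ) ∧
      ((fwStep n m H t N).trace : ℝ) ≤ (2 : ℝ) ^ cp n m + (n : ℝ) ^ 2) ∧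
    (∀ i j, |fwStep n m H t N i j| ≤ 2 ^ cp n m + n + 1) ∧
    (∀ i j, |bOf (fwStep n m H t N) i j - yOf (m := m) (H := H) t N i j| ≤
      ((n : ℝ) ^ 2 + n + 1) / 2 ^ cp n m) := by
  obtain ⟨-, hY, -, -⟩ := fw_facts (H := H) hn hm t hpsd hτ
  have hbr := fwStep_bracket (H := H) hn hm t hpsd hτ
  have hN'symm : ∀ i j, fwStep n m H t N j i = fwStep n m H t N i j := fun i j => by
    have h := congrFun (congrFun (isSymm_fwStep (m := m) (H := H) t hsymm) i) j
    simpa [Matrix.transpose_apply] using h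
  set Y := yOf (m := m) (H := H) t N with hYdef
  set N' := fwStep n m H t N with hN'def
  set p2 : ℝ := (2 : ℝ) ^ cp n m with hp2def
  have hp2 : 0 < p2 := by positivity
  have hn' : (1 : ℝ) ≤ n := by exact_mod_cast hn
  have hn0 : (0 : ℝ) ≤ n := by positivity
  have hnn : (n : ℝ) ≤ (n : ℝ) ^ 2 := by nlinarith
  have hYsymm : ∀ i j, Y j i = Y i j := hY.apply_comm
  have hYabs : ∀ i j, |Y i j| ≤ 1 := hY.abs_apply_le_one
  -- the rounding defect
  set R : Matrix (Fin n) (Fin n) ℝ := fun i j =>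
    p2 * Y i j - (((N' i j : ℤ) : ℝ) - if i = j then (n : ℝ) else 0) with hRdef
  have hR0 : ∀ i j, 0 ≤ R i j := fun i j => by
    have h := (hbr i j).1; simp only [hRdef]; linarith
  have hR1 : ∀ i j, R i j < 1 := fun i j => by
    have h := (hbr i j).2; simp only [hRdef]; linarith
  have hRsymm : ∀ i j, R j i = R i j := fun i j => by
    simp only [hRdef, hYsymm i j, hN'symm i j, eq_comm (a := j) (b := i)]
  have hentry : ∀ i j, ((N' i j : ℤ) : ℝ) = p2 * Y i j + (if i = j then (n : ℝ) else 0) - R i j :=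
    fun i j => by simp only [hRdef]; ring
  have hdecomp : toR N' = p2 • Y + (-R + (n : ℝ) • (1 : Matrix (Fin n) (Fin n) ℝ)) := by
    ext i j
    simp only [toR_apply, Matrix.add_apply, Matrix.smul_apply, Matrix.neg_apply, Matrix.one_apply,
      smul_eq_mul, mul_ite, mul_one, mul_zero, hentry i j]
    ring
  -- positive semidefiniteness
  have hRherm : (-R).IsHermitian := by
    ext i j
    simp only [conjTranspose_apply, star_trivial, Matrix.neg_apply, hRsymm i j]
  have hRabs : ∀ i j, |(-R) i j| ≤ 1 := fun i j => by
    rw [Matrix.neg_apply, abs_neg, abs_of_nonneg (hR0 i j)]; exact (hR1 i j).le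
  have hshift : (-R + (n : ℝ) • (1 : Matrix (Fin n) (Fin n) ℝ)).PosSemidef :=
    posSemidef_add_smul_one hRherm hRabs (le_of_eq (by rw [Fintype.card_fin, mul_one]))
  have hpsd' : (toR N').PosSemidef := by
    rw [hdecomp]
    exact (hY.posSemidef.smul hp2.le).add hshift
  -- the trace
  have htrR0 : 0 ≤ ∑ i, R i i := sum_nonneg fun i _ => hR0 i i
  have htrR1 : ∑ i, R i i ≤ n := by
    calc ∑ i, R i i ≤ ∑ _i : Fin n, (1 : ℝ) := sum_le_sum fun i _ => (hR1 i i).le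
      _ = n := by simp
  have htrY : ∑ i, Y i i = 1 := by
    have h := hY.trace_eq_one; simp only [Matrix.trace, Matrix.diag] at h; exact h
  have htrace : ((N'.trace : ℤ) : ℝ) = p2 + (n : ℝ) * n - ∑ i, R i i := by
    rw [← trace_toR]
    simp only [Matrix.trace, Matrix.diag, toR_apply]
    have hdiag : ∀ i : Fin n, ((N' i i : ℤ) : ℝ) = p2 * Y i i + n - R i i := fun i => by
      rw [hentry i i, if_pos rfl]
    simp only [hdiag, sum_sub_distrib, sum_add_distrib, ← mul_sum, htrY, sum_const, card_univ,
      Fintype.card_fin, nsmul_eq_mul, mul_one]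
  have htr_lo : p2 + (n : ℝ) ^ 2 - n ≤ ((N'.trace : ℤ) : ℝ) := by rw [htrace, sq]; linarith
  have htr_hi : ((N'.trace : ℤ) : ℝ) ≤ p2 + (n : ℝ) ^ 2 := by rw [htrace, sq]; linarith
  have htr_pos : 0 < ((N'.trace : ℤ) : ℝ) := by linarith
  -- entries
  have hite : ∀ i j : Fin n, |(if i = j then (n : ℝ) else 0)| ≤ n := fun i j => by
    split_ifs
    · rw [abs_of_nonneg hn0]
    · rw [abs_zero]; exact hn0
  have habs : ∀ i j, |((N' i j : ℤ) : ℝ)| ≤ p2 + n + 1 := fun i j => by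
    rw [hentry i j]
    have h1 := hYabs i j
    have h2 := hR0 i j
    have h3 := hR1 i j
    have h5 : |p2 * Y i j| ≤ p2 := by
      rw [abs_mul, abs_of_pos hp2]; nlinarith
    calc |p2 * Y i j + (if i = j then (n : ℝ) else 0) - R i j|
        ≤ |p2 * Y i j + (if i = j then (n : ℝ) else 0)| + |R i j| := abs_sub _ _
      _ ≤ (|p2 * Y i j| + |(if i = j then (n : ℝ) else 0)|) + |R i j| :=
          add_le_add (abs_add_le _ _) le_rfl
      _ ≤ p2 + n + 1 := by rw [abs_of_nonneg h2]; linarith [hite i j]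
  refine ⟨hpsd', ⟨htr_lo, htr_hi⟩, fun i j => ?_, fun i j => ?_⟩
  · have h := habs i j
    have h2 : ((2 ^ cp n m + n + 1 : ℤ) : ℝ) = p2 + n + 1 := by push_cast; rw [hp2def]
    have h' : ((|N' i j| : ℤ) : ℝ) ≤ ((2 ^ cp n m + n + 1 : ℤ) : ℝ) := by
      rw [h2, Int.cast_abs]; exact h
    exact_mod_cast h'
  · -- the deviation of the represented point from `Y`
    set τ' : ℝ := ((N'.trace : ℤ) : ℝ) with hτ'def
    have hτ'p2 : p2 ≤ τ' := by linarith
    have hτ'0 : 0 < τ' := htr_pos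
    have hτ'ne : τ' ≠ 0 := hτ'0.ne'
    have hdev : bOf N' i j - Y i j =
        ((p2 - τ') * Y i j + (if i = j then (n : ℝ) else 0) - R i j) / τ' := by
      rw [bOf, Matrix.smul_apply, toR_apply, smul_eq_mul, hentry i j, ← hτ'def]
      field_simp
      ring
    rw [hdev, abs_div, abs_of_pos hτ'0, div_le_div_iff₀ hτ'0 hp2]
    have hnum : |(p2 - τ') * Y i j + (if i = j then (n : ℝ) else 0) - R i j| ≤
        (n : ℝ) ^ 2 + n + 1 := by
      have h1 : |p2 - τ'| ≤ (n : ℝ) ^ 2 := by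
        rw [abs_le]; constructor <;> linarith
      have h2 : |(p2 - τ') * Y i j| ≤ (n : ℝ) ^ 2 := by
        rw [abs_mul]
        calc |p2 - τ'| * |Y i j| ≤ (n : ℝ) ^ 2 * 1 :=
              mul_le_mul h1 (hYabs i j) (abs_nonneg _) (by positivity)
          _ = (n : ℝ) ^ 2 := mul_one _
      calc |(p2 - τ') * Y i j + (if i = j then (n : ℝ) else 0) - R i j|
          ≤ |(p2 - τ') * Y i j + (if i = j then (n : ℝ) else 0)| + |R i j| := abs_sub _ _
        _ ≤ (|(p2 - τ') * Y i j| + |(if i = j then (n : ℝ) else 0)|) + |R i j| :=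
            add_le_add (abs_add_le _ _) le_rfl
        _ ≤ (n : ℝ) ^ 2 + n + 1 := by
            rw [abs_of_nonneg (hR0 i j)]; linarith [hR1 i j, hite i j]
    have hq0 : (0 : ℝ) ≤ (n : ℝ) ^ 2 + n + 1 := by positivity
    calc |(p2 - τ') * Y i j + (if i = j then (n : ℝ) else 0) - R i j| * p2
        ≤ ((n : ℝ) ^ 2 + n + 1) * p2 := mul_le_mul_of_nonneg_right hnum hp2.le
      _ ≤ ((n : ℝ) ^ 2 + n + 1) * τ' := mul_le_mul_of_nonneg_left hτ'p2 hq0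

/-- **All iterates are good**: positive semidefinite, positive trace, entries at most
`2ᵖ + n + 1` (`n ≥ 1`). [cite: Jaggi2011, Alg. 6 (chunk p0020)] -/
theorem fwIter_good (hn : 1 ≤ n) (hm : 1 ≤ m) : ∀ t : ℕ,
    (toR (fwIter n m H t)).PosSemidef ∧ 0 < (fwIter n m H t).trace ∧
      ∀ i j, |fwIter n m H t i j| ≤ 2 ^ cp n m + n + 1
  | 0 => by
    have h1 : toR (1 : Matrix (Fin n) (Fin n) ℤ) = 1 := by rw [toR_eq_mapMatrix, map_one]
    refine ⟨?_, ?_, fun i j => ?_⟩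
    · rw [fwIter, h1]; exact PosSemidef.one
    · rw [fwIter, trace_one, Fintype.card_fin]; exact_mod_cast hn
    · rw [fwIter, Matrix.one_apply]
      have h2 : (0 : ℤ) < 2 ^ cp n m := pow_pos (by norm_num) _
      have hn0 : (0 : ℤ) ≤ n := Int.natCast_nonneg _
      split_ifs <;> simp only [abs_one, abs_zero] <;> linarith
  | t + 1 => by
    obtain ⟨hpsd, hτ, -⟩ := fwIter_good hn hm t
    obtain ⟨h1, ⟨h2, -⟩, h3, -⟩ := fwStep_good (H := H) hn hm t (isSymm_fwIter t) hpsd hτ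
    refine ⟨h1, ?_, h3⟩
    have hn' : (1 : ℝ) ≤ n := by exact_mod_cast hn
    have h : (0 : ℝ) < ((fwStep n m H t (fwIter n m H t)).trace : ℝ) := by
      have h2 : (0 : ℝ) < (2 : ℝ) ^ cp n m := by positivity
      have hnn : (n : ℝ) ≤ (n : ℝ) ^ 2 := by nlinarith
      linarith
    rw [fwIter]
    exact_mod_cast h

/-! ### The objective along the rounded iteration -/

/-- **Rounding moves the objective by at most `ρ = n² · (n²+n+1)/2ᵖ · (1 + 3M)`**:
`|f(B⁺) - f(Y)| ≤ ρ` (`abs_penaltyObj_sub_le` with `δ = (n²+n+1)/2ᵖ ≤ 1`). [folklore] -/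
theorem abs_penaltyObj_fwStep_sub_le (hn : 1 ≤ n) (hm : 1 ≤ m) (t : ℕ)
    {N : Matrix (Fin n) (Fin n) ℤ} (hsymm : N.IsSymm) (hpsd : (toR N).PosSemidef)
    (hτ : 0 < N.trace) :
    |penaltyObj H (cM n m : ℝ) (bOf (fwStep n m H t N)) -
        penaltyObj H (cM n m : ℝ) (yOf (m := m) (H := H) t N)| ≤
      (n : ℝ) ^ 2 * (((n : ℝ) ^ 2 + n + 1) / 2 ^ cp n m) * (1 + 3 * (cM n m : ℝ)) := by
  obtain ⟨-, hY, -, -⟩ := fw_facts (H := H) hn hm t hpsd hτ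
  obtain ⟨-, -, -, hdev⟩ := fwStep_good (H := H) hn hm t hsymm hpsd hτ
  have hM : (0 : ℝ) ≤ (cM n m : ℝ) := Nat.cast_nonneg _
  have hδ0 : (0 : ℝ) ≤ ((n : ℝ) ^ 2 + n + 1) / 2 ^ cp n m := by positivity
  have hδ1 : ((n : ℝ) ^ 2 + n + 1) / 2 ^ cp n m ≤ 1 := by
    rw [div_le_one (by positivity)]; exact quad_le_two_pow_cp hn hm
  have h := abs_penaltyObj_sub_le (H := H) hM hδ0 hδ1 hY.abs_apply_le_one hdev
  rw [Fintype.card_fin] at h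
  exact h

/-- **The primal error after `T` steps is below `3/(8m)`**: Jaggi's recurrence with oracle error
`1/(8m)`, curvature `4M` (`16M/(T+2) < 1/(32m)`) and accumulated rounding `Tρ < 3/(16m)`.
[cite: Jaggi2011, Thm. 17 (chunk p0022)] -/
theorem err_fwFinal_lt (hn : 1 ≤ n) (hm : 1 ≤ m) :
    lovaszTheta H - penaltyObj H (cM n m : ℝ) (bOf (fwFinal n m H)) < 3 / (8 * (m : ℝ)) := by
  set h : ℕ → ℝ := fun t => lovaszTheta H - penaltyObj H (cM n m : ℝ) (bOf (fwIter n m H t)) with hh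
  have hn' : (1 : ℝ) ≤ n := by exact_mod_cast hn
  have hm' : (1 : ℝ) ≤ m := by exact_mod_cast hm
  have hM1 : (1 : ℝ) ≤ (cM n m : ℝ) := by exact_mod_cast one_le_cM hn hm
  have hC : (0 : ℝ) ≤ 4 * (cM n m : ℝ) := by positivity
  set ρ : ℝ := (n : ℝ) ^ 2 * (((n : ℝ) ^ 2 + n + 1) / 2 ^ cp n m) * (1 + 3 * (cM n m : ℝ)) with hρdef
  have hρ : 0 ≤ ρ := by positivity
  have hstep : ∀ t : ℕ, h (t + 1) ≤ (1 - 2 / ((t : ℝ) + 2)) * h t +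
      2 / ((t : ℝ) + 2) * (4 * (1 / (cq n m : ℝ)) * (c0 n m : ℝ)) +
      (2 / ((t : ℝ) + 2)) ^ 2 * (4 * (cM n m : ℝ)) + ρ := fun t => by
    obtain ⟨hpsd, hτ, -⟩ := fwIter_good (H := H) hn hm t
    obtain ⟨-, -, hdec, -⟩ := fw_facts (H := H) hn hm t hpsd hτ
    have hround := abs_penaltyObj_fwStep_sub_le (H := H) hn hm t (isSymm_fwIter t) hpsd hτ
    rw [abs_le] at hround
    simp only [hh, fwIter]
    rw [hρdef]
    linarith [hround.1]
  have hrec := frankWolfe_recurrence h hC hρ hstep (cT n m) (one_le_cT hn hm)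
  -- evaluate the three terms
  have hq : 4 * (1 / (cq n m : ℝ)) * (c0 n m : ℝ) = 1 / (8 * (m : ℝ)) := by
    have hc0 : (0 : ℝ) < (c0 n m : ℝ) := by exact_mod_cast one_le_c0 (m := m) hn
    rw [cq_cast]; field_simp; ring
  have hterm1 : 4 * (4 * (cM n m : ℝ)) / ((cT n m : ℕ) + 2 : ℝ) < 1 / (32 * (m : ℝ)) := by
    rw [cT_cast, cM_cast, div_lt_div_iff₀ (by positivity) (by positivity)]
    nlinarith [pow_pos (by positivity : (0 : ℝ) < n) 6]
  have hterm3 : (cT n m : ℝ) * ρ ≤ 3 / (16 * (m : ℝ)) := by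
    have hP := lt_two_pow_cp_real (n := n) (m := m)
    have h2p : (0 : ℝ) < 2 ^ cp n m := by positivity
    -- `Tρ = 512 n⁸ m² (n²+n+1)(1+3M) / 2ᵖ ≤ 6144 n¹⁶ m³ / 2ᵖ ≤ 3/(16m)`
    have hA : (n : ℝ) ^ 2 + n + 1 ≤ 3 * (n : ℝ) ^ 2 := by nlinarith
    have hB : 1 + 3 * (cM n m : ℝ) ≤ 4 * ((n : ℝ) ^ 6 * m) := by rw [cM_cast] at hM1 ⊢; linarith
    have hexpr : (cT n m : ℝ) * ρ =
        512 * (n : ℝ) ^ 8 * (m : ℝ) ^ 2 * (((n : ℝ) ^ 2 + n + 1) * (1 + 3 * (cM n m : ℝ))) / 2 ^ cp n m := by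
      rw [cT_cast, hρdef]; ring
    have hprod : ((n : ℝ) ^ 2 + n + 1) * (1 + 3 * (cM n m : ℝ)) ≤ 3 * (n : ℝ) ^ 2 * (4 * ((n : ℝ) ^ 6 * m)) :=
      mul_le_mul hA hB (by positivity) (by positivity)
    rw [hexpr, div_le_div_iff₀ h2p (by positivity)]
    calc 512 * (n : ℝ) ^ 8 * (m : ℝ) ^ 2 * (((n : ℝ) ^ 2 + n + 1) * (1 + 3 * (cM n m : ℝ))) * (16 * (m : ℝ))
        ≤ 512 * (n : ℝ) ^ 8 * (m : ℝ) ^ 2 * (3 * (n : ℝ) ^ 2 * (4 * ((n : ℝ) ^ 6 * m))) * (16 * (m : ℝ)) := by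
          gcongr
      _ = 3 * ((2 : ℝ) ^ 15 * (n : ℝ) ^ 16 * (m : ℝ) ^ 4) := by ring
      _ ≤ 3 * 2 ^ cp n m := by linarith
  have hfin : h (cT n m) < 3 / (8 * (m : ℝ)) := by
    have hm0 : (0 : ℝ) < m := by linarith
    have hsum : 1 / (32 * (m : ℝ)) + 1 / (8 * (m : ℝ)) + 3 / (16 * (m : ℝ)) < 3 / (8 * (m : ℝ)) := by
      have h11 : 1 / (32 * (m : ℝ)) + 1 / (8 * (m : ℝ)) + 3 / (16 * (m : ℝ)) = 11 / (32 * (m : ℝ)) := by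
        field_simp; ring
      rw [h11, div_lt_div_iff₀ (by positivity) (by positivity)]
      nlinarith
    rw [hq] at hrec
    linarith
  simpa [hh, fwFinal] using hfin

/-! ### The output -/

/-- **Correctness of the output**: `m ϑ(H) ≤ z ≤ m ϑ(H) + 2` for `z = thetaZ n m H`, `n, m ≥ 1`
(`z = ⌈m f_M(B_T) + 3/8⌉`, `ϑ - 3/(8m) < f_M(B_T) ≤ ϑ + 1/(4m)`).
[cite: Jaggi2011, Thm. 17 (chunk p0022)] [cite: GrotschelLovaszSchrijver1981, §6 (pp. 192–194)] -/
theorem thetaZ_spec (hn : 1 ≤ n) (hm : 1 ≤ m) :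
    (m : ℝ) * lovaszTheta H ≤ (thetaZ n m H : ℝ) ∧
      (thetaZ n m H : ℝ) ≤ m * lovaszTheta H + 2 := by
  haveI : Nonempty (Fin n) := ⟨⟨0, hn⟩⟩
  obtain ⟨hpsd, hτ, -⟩ := fwIter_good (H := H) hn hm (cT n m)
  have hm' : (1 : ℝ) ≤ m := by exact_mod_cast hm
  have hM0 : (0 : ℝ) < (cM n m : ℝ) := by exact_mod_cast one_le_cM hn hm
  have hB : IsSpectraplex (bOf (fwFinal n m H)) := isSpectraplex_bOf hpsd hτ
  have hb : (0 : ℤ) < 8 * (fwFinal n m H).trace ^ 2 := by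
    have : (0 : ℤ) < (fwFinal n m H).trace := hτ
    positivity
  obtain ⟨hz1, hz2⟩ := ceilDiv_bracket (outNum n m H (fwFinal n m H)) hb
  have hout := outNum_div (m := m) (H := H) (N := fwFinal n m H) hτ.ne'
  rw [hout] at hz1 hz2
  have herr := err_fwFinal_lt (H := H) hn hm
  have hup := penaltyObj_le (H := H) hM0 hB
  have h14 : (Fintype.card (Fin n) : ℝ) ^ 6 / (4 * (cM n m : ℝ)) = 1 / (4 * (m : ℝ)) := by
    rw [Fintype.card_fin, cM_cast]
    have hn0 : (n : ℝ) ≠ 0 := by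
      have : (1 : ℝ) ≤ n := by exact_mod_cast hn
      positivity
    have hm0 : (m : ℝ) ≠ 0 := by positivity
    field_simp
  rw [h14] at hup
  set f := penaltyObj H (cM n m : ℝ) (bOf (fwFinal n m H)) with hf
  set z : ℝ := (thetaZ n m H : ℝ) with hzdef
  have hz1' : (m : ℝ) * f + 3 / 8 ≤ z := hz1
  have hz2' : z < (m : ℝ) * f + 3 / 8 + 1 := hz2
  have hm0 : (0 : ℝ) < m := by linarith
  constructor
  · -- lower bound: `m ϑ < m f + 3/8 ≤ z`
    have h1 : (m : ℝ) * (lovaszTheta H - f) < (m : ℝ) * (3 / (8 * (m : ℝ))) :=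
      mul_lt_mul_of_pos_left herr hm0
    have h2 : (m : ℝ) * (3 / (8 * (m : ℝ))) = 3 / 8 := by field_simp
    nlinarith
  · -- upper bound: `z < m f + 11/8 ≤ m ϑ + 1/4 + 11/8`
    have h1 : (m : ℝ) * f ≤ (m : ℝ) * (lovaszTheta H + 1 / (4 * (m : ℝ))) :=
      mul_le_mul_of_nonneg_left hup hm0.le
    have h2 : (m : ℝ) * (lovaszTheta H + 1 / (4 * (m : ℝ))) = m * lovaszTheta H + 1 / 4 := by
      field_simp
    nlinarith

/-- The output is nonnegative (`z ≥ m ϑ ≥ 0`). [folklore] -/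
theorem thetaZ_nonneg (hn : 1 ≤ n) (hm : 1 ≤ m) : 0 ≤ thetaZ n m H := by
  have h := (thetaZ_spec (H := H) hn hm).1
  have h0 : (0 : ℝ) ≤ (m : ℝ) * lovaszTheta H := mul_nonneg (Nat.cast_nonneg _) (lovaszTheta_nonneg H)
  exact_mod_cast h0.trans h

/-- **The output as a natural number**: `z = (thetaZ n m H).toNat` satisfies
`m ϑ(H) ≤ z ≤ m ϑ(H) + 2` — the specification of
`Literature.Computability.Complexity.GLS1981_thetaApprox_unary_FP` at `(H, m)`, `n, m ≥ 1`.
[cite: GrotschelLovaszSchrijver1981, §6 (pp. 192–194)] [cite: Tardos1988, p. 142] -/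
theorem thetaZ_toNat_spec (hn : 1 ≤ n) (hm : 1 ≤ m) :
    (m : ℝ) * lovaszTheta H ≤ ((thetaZ n m H).toNat : ℝ) ∧
      (((thetaZ n m H).toNat : ℕ) : ℝ) ≤ m * lovaszTheta H + 2 := by
  have hcast : (((thetaZ n m H).toNat : ℕ) : ℝ) = (thetaZ n m H : ℝ) := by
    have h := Int.toNat_of_nonneg (thetaZ_nonneg (H := H) hn hm)
    exact_mod_cast h
  rw [hcast]
  exact thetaZ_spec hn hm

end ThetaFW

end Literature.Combinatorics.SimpleGraph

end
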